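import Summits.QuantumFields.YangMills.Theorems.BalabanLadderIRcofEquipartitionSeamKernelDefs
import HarnessLib

/-!
# Line `equipartition_seam` — KERNEL CURRENCY sketch rev 5 (g6; NOT registered): BRIDGES over the LANDED defs module (p687323 + append p687588 `elPart`)

The rev-8 (β) texts are LANDED: `Theorems/BalabanLadderIRcofEquipartitionSeamKernelDefs.lean` (p687323, LEAD ab-p1 g8, bus l.1631; = rev 3
5128c8e98283 §A–§C′ of this sketch VERBATIM — S3ʷ `EquiWindowV` FLOOR-FREE (R1), `0 ≤ nrm A` in D's species clause, (N-b) dressing anchored on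
the weight; crit-3 TYPEREAD CLEAN l.1618 ∕ l.1625).  This sketch now IMPORTS that file and keeps ONLY the bridge layer (§D), so that its
elaboration is evidence that the LANDED texts are consumable as typed: **B1 `equiUnits_of_window : EquiWindowV → LabelNoiseV → SplitVanishing →
EquiUnits` PROVED (0 sorry)**, the (N-b) arithmetic core of B2 `eblind_transport` PROVED, and B2 `eblindUnitsV_of_peeling : EquiWindowV →
VacuumSlackV → SpectralDictV → LabelNoiseV → EBlindUnitsV` stated (`sorry`; pool-p3 g16 owns it in the landing file of record
`Theorems/BalabanLadderIRcofEquipartitionSeamKernelBridges.lean`, `--supports stmt-QuantumFields-26930`).  rev 4's header placement of the sign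
clause (b3347da4247f) and the staging copy `Lines/equipartition_seam_KernelDefs.lean` (511fab2419eb) are SUPERSEDED by the landed file (my LAND-ASK
l.1628 crossed with the landing l.1631; the placement difference is immaterial — B2 reads `0 ≤ nrm A` where it consumes the species clause).

Rev 8 of the skeleton then reads `irnscCof_of_stubs := irnscCof_of_coverGapCofAll (coverGapCofAll_of stub_struct splitVanishing_holds
(equiUnits_of_window stub_equiWindowV stub_labelNoiseV splitVanishing_holds) (eblindUnitsV_of_peeling stub_equiWindowV stub_vacuumSlackV
stub_spectralDictV stub_labelNoiseV) stub_pscUnitsCofV badRareUnits_holds mixUnits_holds)` — SIX stubs {S1, S3ʷ, T, D, N, S5ᵛ} ≤ 7,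
`coverGapCofAll_of` ∕ `IRcof_of_stubs` UNCHANGED (C-iv) — cut only after the bridges file is ACCEPTED with B2 sorry-free, then crit-3's STAMP.

HONEST: two elementary ε-lemmas and one bridge; nothing located is proved (S1, S3ʷ, T, N, S5ᵛ open; D unproved); `IRcof`/`IR` 0∕1; row 47 PWP,
open stubs 4 of record (rev 7 b786d9ea556a), mechanism 0; nothing continuum/OS; the Yang–Mills mass gap (Clay) is NOT proved by any of this.
-/

noncomputable section

open MeasureTheory Filter Topology
open Literature.MathematicalPhysics.QuantumFieldTheory Literature.MathematicalPhysics.QuantumLattice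
open Summit.QuantumFields.YangMills.Cruxes.OSLegsFromFemtoAndGap.DlrCollarTransfer (LowerBounds)
open Summit.QuantumFields.YangMills.Theorems.NonSimplyConnectedLatticeGap
open Summit.QuantumFields.YangMills.Cruxes.IRcof.EquipartitionSeam

namespace Summit.QuantumFields.YangMills.Cruxes.IRcof.EquipartitionSeam.KernelCurrency

/-! ## §D BRIDGES (signatures for pool provers — `sorry` here only) -/

section BridgeOne

variable {G H : Type} [Group G] [Group H]

/-- LOCAL helper name (= the tree decl `KernelCurrency.elPart` of append p687588 VERBATIM; a distinct name is used so that this workfile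
elaborates on every farm node during the rebuild window of the appended module and never clashes with it afterwards). -/
def elPartLoc (π : H →* G) (z : Sector π) : Fin 3 → ↥π.ker := fun i => z ⟨(0, i.succ), Fin.succ_pos i⟩

/-- Electrically related sectors are members of one electric family: `z₀|elPart z = z`. -/
theorem withEl_elPart_of_rel (π : H →* G) {z₀ z : Sector π} (hrel : ∀ q : Plane, q.1.1 ≠ 0 → z₀ q = z q) :
    withEl π z₀ (elPartLoc π z) = z := by
  funext q
  unfold withEl elPartLoc
  split_ifs with h
  · congr 1
    apply Subtype.ext
    apply Prod.ext
    · simpa using h.symm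
    · apply Fin.ext
      have h2 : (q.1.1 : ℕ) < q.1.2 := q.2
      have h3 : (q.1.1 : ℕ) = 0 := by simpa using congrArg Fin.val h
      simp only [Fin.val_succ]
      omega
  · exact hrel q h

theorem withEl_elPart_self (π : H →* G) (z : Sector π) : withEl π z (elPartLoc π z) = z :=
  withEl_elPart_of_rel π fun _ _ => rfl

/-- The real-arithmetic core of B1: canonical EQUI at defect `ε ≤ 3τ/8` + label noise `τ/8` ⇒ label EQUI at rate `τ ≤ 1`. -/
theorem equi_transport {pz pw Zz Zw N τ ε ν : ℝ} (hτ : 0 ≤ τ) (hτ1 : τ ≤ 1) (hεb : 8 * ε ≤ 3 * τ)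
    (hν : ν = τ / 8) (hNp : 0 < N) (hpz : 0 ≤ pz) (hpw : 0 ≤ pw) (hE : |Zz - Zw| ≤ ε * Zw)
    (hz : |pz - N * Zz| ≤ ν * (N * Zz)) (hw : |pw - N * Zw| ≤ ν * (N * Zw)) : |pz - pw| ≤ τ * pw := by
  subst hν
  have hν0 : 0 ≤ τ / 8 := by positivity
  obtain ⟨hz1, hz2⟩ := abs_le.mp hz
  obtain ⟨hw1, hw2⟩ := abs_le.mp hw
  obtain ⟨hE1, hE2⟩ := abs_le.mp hE
  have hXw : 0 ≤ N * Zw := by nlinarith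
  have hXz : 0 ≤ N * Zz := by nlinarith
  have hZw : 0 ≤ Zw := by
    by_contra hc; have hc' := lt_of_not_ge hc; nlinarith
  have h1 : |pz - pw| ≤ τ / 8 * (N * Zz) + N * (ε * Zw) + τ / 8 * (N * Zw) := by
    have ha : |pz - pw| ≤ |pz - N * Zz| + |N * Zz - N * Zw| + |N * Zw - pw| := by
      calc |pz - pw| = |(pz - N * Zz) + (N * Zz - N * Zw) + (N * Zw - pw)| := by ring_nf
        _ ≤ |(pz - N * Zz) + (N * Zz - N * Zw)| + |N * Zw - pw| := abs_add_le _ _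
        _ ≤ |pz - N * Zz| + |N * Zz - N * Zw| + |N * Zw - pw| := by gcongr; exact abs_add_le _ _
    have hb : |N * Zz - N * Zw| ≤ N * (ε * Zw) := by
      rw [← mul_sub, abs_mul, abs_of_pos hNp]; exact mul_le_mul_of_nonneg_left hE hNp.le
    have hc : |N * Zw - pw| ≤ τ / 8 * (N * Zw) := by rw [abs_sub_comm]; exact hw
    linarith
  have h2 : N * Zz ≤ N * Zw + N * (ε * Zw) := by nlinarith
  have h3 : N * Zw * (1 - τ / 8) ≤ pw := by nlinarith
  have h4 : |pz - pw| ≤ N * Zw * (2 * (τ / 8) + τ / 8 * ε + ε) := by nlinarith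
  have h5 : 2 * (τ / 8) + τ / 8 * ε + ε ≤ τ * (1 - τ / 8) := by nlinarith
  calc |pz - pw| ≤ N * Zw * (2 * (τ / 8) + τ / 8 * ε + ε) := h4
    _ ≤ N * Zw * (τ * (1 - τ / 8)) := mul_le_mul_of_nonneg_left h5 hXw
    _ = τ * (N * Zw * (1 - τ / 8)) := by ring
    _ ≤ τ * pw := mul_le_mul_of_nonneg_left h3 hτ

/-- `8 e^{−(2S+2)} ≤ 3 e^{−(2S+1)}` (`e ≥ 8/3`). -/
theorem eight_exp_window_le (S : ℕ) : 8 * Real.exp (-(2 * (S : ℝ) + 2)) ≤ 3 * Real.exp (-(2 * (S : ℝ) + 1)) := by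
  have h1 : Real.exp (-(2 * (S : ℝ) + 2)) = Real.exp (-(2 * (S : ℝ) + 1)) * Real.exp (-1) := by
    rw [← Real.exp_add]; ring_nf
  have he : 8 * Real.exp (-1) ≤ 3 := by
    have h := Real.exp_one_gt_d9
    rw [Real.exp_neg]
    rw [inv_eq_one_div, mul_one_div, div_le_iff₀ (Real.exp_pos 1)]
    linarith
  rw [h1]
  nlinarith [Real.exp_pos (-(2 * (S : ℝ) + 1))]

end BridgeOne

/-- **B1 (PROVED)** S3 from S3ʷ (`s = 2S+1`) + N: `|p_z − p_w| ≤ N Z_w (2ν + νε + ε) ≤ τ (1−ν) N Z_w ≤ τ p_w` at `ν = τ/8`, `ε ≤ 3τ/8`,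
`τ = e^{−(2S+1)}`; the split family from S2ᵛ. -/
theorem equiUnits_of_window (h3w : EquiWindowV) (hN : LabelNoiseV) (h2 : SplitVanishing) : EquiUnits := by
  intro G _ _ _ _ _ _ hG H _ _ _ _ _ _ hH hsc π hπc hπs hker hfin hnt ρH r au hpos h0 hLB a cls hI
  obtain ⟨c, hc, β_s, hws⟩ := h2 G hG H hH hsc π hπc hπs hker hfin hnt ρH r
  obtain ⟨β_e, S_e, hE⟩ := h3w G hG H hH hsc π hπc hπs hker hfin hnt ρH r c hc
  obtain ⟨β_N, S_N, hNN⟩ := hN G hG H hH hsc π hπc hπs hker hfin hnt ρH r a cls hI c hc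
  refine ⟨max β_s (max β_e β_N), fun β => max (S_e β) (S_N β), fun β hβ S z zw hS hrel => ?_⟩
  have hβs : β_s ≤ β := le_trans (le_max_left _ _) hβ
  have hβe : β_e ≤ β := le_trans (le_trans (le_max_left _ _) (le_max_right _ _)) hβ
  have hβN : β_N ≤ β := le_trans (le_trans (le_max_right _ _) (le_max_right _ _)) hβ
  obtain ⟨w, hw⟩ := hws β hβs
  have hSe : S_e β ≤ S := le_trans (le_max_left _ _) hS
  have hSN : S_N β ≤ S := le_trans (le_max_right _ _) hS
  -- canonical EQUI at `s = 2S+1` (inside the window)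
  have hEq := hE β hβe w hw S hSe (2 * S + 1) (by omega) le_rfl z zw hrel
  -- label noise for the electric family of `z`
  obtain ⟨Nrm, hNrm, hwt, -⟩ := hNN β hβN w hw S hSN z
  have hz := hwt (elPartLoc π z)
  have hzw := hwt (elPartLoc π zw)
  rw [withEl_elPart_self] at hz
  rw [withEl_elPart_of_rel π hrel] at hzw
  exact equi_transport (Real.exp_pos _).le (by rw [Real.exp_le_one_iff]; linarith) (eight_exp_window_le S) (by ring) hNrm
    ENNReal.toReal_nonneg ENNReal.toReal_nonneg hEq hz hzw

/-- The real-arithmetic core of B2 in the (N-b) currency: a canonical EBLIND cross-bound `|W_z Z_w − W_w Z_z| ≤ M Z_z Z_w`, the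
canonical species bound `|W| ≤ K' Z`, and the label noise N (weights `ν`, species `ν C` with the dressing `J` anchored on the WEIGHTS, so that
it cancels identically) give the label-currency cross-bound with constant `4/3 · (M + 2ν(K' + C))` (`ν ≤ 1/8`). -/
theorem eblind_transport {pz pw Iz Iw Zz Zw Wz Ww N J ν C K' M : ℝ} (hν : 0 ≤ ν) (hν1 : 8 * ν ≤ 1) (hC : 0 ≤ C)
    (hK' : 0 ≤ K') (hM : 0 ≤ M) (hNp : 0 < N) (hpz : 0 ≤ pz) (hpw : 0 ≤ pw)
    (hWz : |Wz| ≤ K' * Zz) (hWw : |Ww| ≤ K' * Zw) (hcross : |Wz * Zw - Ww * Zz| ≤ M * (Zz * Zw))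
    (hz : |pz - N * Zz| ≤ ν * (N * Zz)) (hw : |pw - N * Zw| ≤ ν * (N * Zw))
    (hIz : |Iz - (N * Wz + J * pz)| ≤ ν * C * (N * Zz)) (hIw : |Iw - (N * Ww + J * pw)| ≤ ν * C * (N * Zw)) :
    |pw * Iz - pz * Iw| ≤ 4 / 3 * (M + 2 * ν * (K' + C)) * (pz * pw) := by
  obtain ⟨hz1, hz2⟩ := abs_le.mp hz
  obtain ⟨hw1, hw2⟩ := abs_le.mp hw
  have hXw : 0 ≤ N * Zw :=
    (mul_nonneg_iff_of_pos_left (by linarith : (0 : ℝ) < 1 + ν)).mp (by nlinarith)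
  have hXz : 0 ≤ N * Zz :=
    (mul_nonneg_iff_of_pos_left (by linarith : (0 : ℝ) < 1 + ν)).mp (by nlinarith)
  have hZw : 0 ≤ Zw := (mul_nonneg_iff_of_pos_left hNp).mp hXw
  have hZz : 0 ≤ Zz := (mul_nonneg_iff_of_pos_left hNp).mp hXz
  have hid : pw * Iz - pz * Iw = N ^ 2 * (Wz * Zw - Ww * Zz) + (pw - N * Zw) * (N * Wz) - (pz - N * Zz) * (N * Ww) +
      pw * (Iz - (N * Wz + J * pz)) - pz * (Iw - (N * Ww + J * pw)) := by ring
  have t1 : |N ^ 2 * (Wz * Zw - Ww * Zz)| ≤ N ^ 2 * (M * (Zz * Zw)) := by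
    rw [abs_mul, abs_of_nonneg (by positivity : (0:ℝ) ≤ N ^ 2)]
    exact mul_le_mul_of_nonneg_left hcross (by positivity)
  have t2 : |(pw - N * Zw) * (N * Wz)| ≤ ν * (N * Zw) * (N * (K' * Zz)) := by
    rw [abs_mul, abs_mul, abs_of_pos hNp]
    exact mul_le_mul hw (mul_le_mul_of_nonneg_left hWz hNp.le) (by positivity) (by positivity)
  have t3 : |(pz - N * Zz) * (N * Ww)| ≤ ν * (N * Zz) * (N * (K' * Zw)) := by
    rw [abs_mul, abs_mul, abs_of_pos hNp]
    exact mul_le_mul hz (mul_le_mul_of_nonneg_left hWw hNp.le) (by positivity) (by positivity)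
  have t4 : |pw * (Iz - (N * Wz + J * pz))| ≤ pw * (ν * C * (N * Zz)) := by
    rw [abs_mul, abs_of_nonneg hpw]; exact mul_le_mul_of_nonneg_left hIz hpw
  have t5 : |pz * (Iw - (N * Ww + J * pw))| ≤ pz * (ν * C * (N * Zw)) := by
    rw [abs_mul, abs_of_nonneg hpz]; exact mul_le_mul_of_nonneg_left hIw hpz
  have habs : |pw * Iz - pz * Iw| ≤ (M + 2 * ν * K') * ((N * Zz) * (N * Zw)) +
      ν * C * (pw * (N * Zz) + pz * (N * Zw)) := by
    rw [hid]
    have h1 := abs_sub (N ^ 2 * (Wz * Zw - Ww * Zz) + (pw - N * Zw) * (N * Wz) - (pz - N * Zz) * (N * Ww) +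
      pw * (Iz - (N * Wz + J * pz))) (pz * (Iw - (N * Ww + J * pw)))
    have h2 := abs_add_le (N ^ 2 * (Wz * Zw - Ww * Zz) + (pw - N * Zw) * (N * Wz) - (pz - N * Zz) * (N * Ww))
      (pw * (Iz - (N * Wz + J * pz)))
    have h3 := abs_sub (N ^ 2 * (Wz * Zw - Ww * Zz) + (pw - N * Zw) * (N * Wz)) ((pz - N * Zz) * (N * Ww))
    have h4 := abs_add_le (N ^ 2 * (Wz * Zw - Ww * Zz)) ((pw - N * Zw) * (N * Wz))
    have hs : N ^ 2 * (M * (Zz * Zw)) + ν * (N * Zw) * (N * (K' * Zz)) + ν * (N * Zz) * (N * (K' * Zw)) =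
        (M + 2 * ν * K') * ((N * Zz) * (N * Zw)) := by ring
    linarith [t1, t2, t3, t4, t5]
  -- lower bounds `N Z (1 - ν) ≤ p`, hence `N Z ≤ (8/7) p`
  have h1 : N * Zz * (1 - ν) ≤ pz := by
    have e : N * Zz * (1 - ν) = N * Zz - ν * (N * Zz) := by ring
    linarith
  have h2 : N * Zw * (1 - ν) ≤ pw := by
    have e : N * Zw * (1 - ν) = N * Zw - ν * (N * Zw) := by ring
    linarith
  have hQ : 0 ≤ (N * Zz) * (N * Zw) := mul_nonneg hXz hXw
  have hlow : N * Zz * (1 - ν) * (N * Zw * (1 - ν)) ≤ pz * pw :=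
    mul_le_mul h1 h2 (mul_nonneg hXw (by linarith)) hpz
  have h34 : 3 / 4 ≤ (1 - ν) ^ 2 := by nlinarith
  have hden : (N * Zz) * (N * Zw) ≤ 4 / 3 * (pz * pw) := by
    have e1 : (N * Zz) * (N * Zw) * (3 / 4) ≤ (N * Zz) * (N * Zw) * (1 - ν) ^ 2 := mul_le_mul_of_nonneg_left h34 hQ
    have e2 : (N * Zz) * (N * Zw) * (1 - ν) ^ 2 = N * Zz * (1 - ν) * (N * Zw * (1 - ν)) := by ring
    linarith
  have hlin : pw * (N * Zz) + pz * (N * Zw) ≤ 8 / 3 * (pz * pw) := by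
    have e1 : N * Zz * (7 / 8) ≤ N * Zz * (1 - ν) := mul_le_mul_of_nonneg_left (by linarith) hXz
    have e2 : N * Zw * (7 / 8) ≤ N * Zw * (1 - ν) := mul_le_mul_of_nonneg_left (by linarith) hXw
    have f1 : pw * (N * Zz) ≤ pw * (8 / 7 * pz) := mul_le_mul_of_nonneg_left (by linarith) hpw
    have f2 : pz * (N * Zw) ≤ pz * (8 / 7 * pw) := mul_le_mul_of_nonneg_left (by linarith) hpz
    nlinarith
  have hcoef1 : 0 ≤ M + 2 * ν * K' := by positivity
  have hνC : 0 ≤ ν * C := mul_nonneg hν hC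
  calc |pw * Iz - pz * Iw| ≤ (M + 2 * ν * K') * ((N * Zz) * (N * Zw)) + ν * C * (pw * (N * Zz) + pz * (N * Zw)) := habs
    _ ≤ (M + 2 * ν * K') * (4 / 3 * (pz * pw)) + ν * C * (8 / 3 * (pz * pw)) :=
        add_le_add (mul_le_mul_of_nonneg_left hden hcoef1) (mul_le_mul_of_nonneg_left hlin hνC)
    _ = 4 / 3 * (M + 2 * ν * (K' + C)) * (pz * pw) := by ring

/-- **B2** S4ᵛ from S3ʷ + T + D + N through `ThickSpeciesDatum.eblind_thick_re`∕`_pow` (p685489): per species `A`, for `4·thick A ≤ 2S+1`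
the canonical cross-difference is `≤ 40 · nrm A · C_T · e^{−(2S+2)} Z Z'`, transported to label classes by N; the finitely many `S` with
`4·thick A > 2S+1` are absorbed into `C(A) ≥ 2 C_A e^{4·thick A + 1}` (species bound `A.bounded`), so `S_b(β)` is species-UNIFORM. -/
theorem eblindUnitsV_of_peeling (h3w : EquiWindowV) (hT : VacuumSlackV) (hD : SpectralDictV) (hN : LabelNoiseV) :
    EBlindUnitsV := by
  sorry

end Summit.QuantumFields.YangMills.Cruxes.IRcof.EquipartitionSeam.KernelCurrency

end

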